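import Summits.ValiantsHypothesis.ValiantsHypothesis.Theses.KPlusLogSqLaw
import Summits.ValiantsHypothesis.ValiantsHypothesis.Theorems.LacunarySymmetroidMatrixDescartesStubArith4

/-!
# Route «KPlusLogSqLaw», octave line — file 1/7: the octave statistic, the octave laws (defined, open), the bridges and the deciding chain

HONEST FRAMING.  Octave line of ideator seat val-idea-6 (crux-idea `octave-lifting` on stmt-ValiantsHypothesis-19561, critic-1 PASS 2026-08-27), published as `Cruxes/WeakLifting/Lines/octave.lean`; landed in Theorems shape by prover seat val-width-19561-oc1 (`--supports stmt-ValiantsHypothesis-19561`).  Conjecture B (`KPlusLogSqLaw`), `TropicalB` (stmt-19771), `WeakLifting` (stmt-19561), `MatrixDescartes` (stmt-18050) and the octave statements `OctaveWeakLifting` / `OctaveKLaw` / `OctaveMatrixDescartes` are OPEN and DEFINED, never asserted; nothing in this file proves any of them, and VP ≠ VNP is not moved.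

WHAT THE LINE PROVES (across files 1–7).  Conjecture B (`KPlusLogSqLaw`), `TropicalB` (stmt-ValiantsHypothesis-19771), `WeakLifting`
(stmt-ValiantsHypothesis-19561), `MatrixDescartes` (stmt-ValiantsHypothesis-18050) are OPEN; nothing here proves any of them or any part of
them, and nothing here bears on VP ≠ VNP except through the OPEN statements `OctaveWeakLifting` / `OctaveKLaw` / `OctaveMatrixDescartes`
DEFINED (never asserted) below.  PROVED (0 sorry): `octaveCount p ≤ #roots` (every octave statement is WEAKER than its root-count twin:
`octaveKLaw_of_kPlusLogSqLaw`, `octaveWeakLifting_of_weakLifting`, `octaveMatrixDescartes_of_matrixDescartes`); the deciding chain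
`valiant_of_octave : TropicalB → OctaveWeakLifting → OctaveThetaWitness → VP_ℂ ≠ VNP_ℂ` with `octaveThetaWitness_proof` (Tavenas' `V_ν`
has one root per sixteen-fold scale), hence `valiant_of_tropicalB_of_octaveWeakLifting`, `valiant_of_octaveKLaw`,
`valiant_of_octaveMatrixDescartes'` (the closed `pencilTransfer_proof` transfers root SETS, hence octave counts); the split
`kPlusLogSqLaw_iff_octave_and_perOctave : KPlusLogSqLaw ↔ OctaveKLaw ∧ PerOctaveKLaw` (scales × clusters, `Z ≤ 1 + P·Ω` by the format- and
symmetry-preserving dyadic rescaling `S_l ↦ 2^{j d_l} S_l`) together with its CORRECTION `kPlusLogSqLaw_iff_perOctaveKLaw : KPlusLogSqLaw ↔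
PerOctaveKLaw` (odd degree dilation `d ↦ q·d`, `f(x) ↦ f(x^q)`, compresses all root scales into one octave: Conjecture B localises to ONE
octave, so the per-octave half is B itself and the informative direction is that the octave half — the one Valiant consumes — is WEAKER);
and the depth-bounded RUNG
`shallowOctaveLifting_proof : ShallowOctaveLifting` (PROVED, 0 sorry: `TropRowD m K n` ⇒ every (m,K) real pencil of cancellation depth ≤ Δ has
its nonzero real roots in ≤ (2(m(log₂(mK)+1)+Δ)+3)(n+1) dyadic octaves) from its three proved pieces `designPiecesBound_proof` (TropRowD ⇒
breakpoint count of a REAL-valued design: sorted breakpoints ⇒ real chain ⇒ the integerisation `realChainBound_proof` with a binary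
tie-breaker and a margin argument), `rootNearBreakpoint_proof` (Leibniz `pencilDet_eq_sum` + `rawConfinement` + `envelopeGap`) and `cellCount_proof`.

THE STATISTIC.  `octave x = ⌊log₂ |x|⌋` (as `Int.log 2 |x|`), `octaveCount p` = number of dyadic octaves carrying a
nonzero real root of `p`.  Valiant's criterion via real roots (Koiran / Tavenas, route LacunarySymmetroid) only ever
uses roots that sit ONE PER SCALE (Tavenas' `V_ν`: one root in each `(x_{u+1}, x_u)`, `x_u = -4^{2u+1}/4^N`, sixteen-fold
apart), so the deciding chain runs on `octaveCount` instead of `card roots`: `OctaveThetaWitness` is the same witness.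

WHY (lens «assume the law fails»).  A counterexample family to B must be one of: (i) a tropical monster (¬TropicalB);
(ii) a SPREAD monster — super-polynomially many root SCALES with no design shadow, which by the depth-confinement lemma
(`rawConfinement` + `envelopeGap`, both proved: every root scale lies within log₂(#Leibniz terms) + δ(F) of a breakpoint of
the design envelope, δ(F) = cancellation depth) costs cancellation depth δ ≥ 2^{C(K+log² m)}, i.e. doubly-exponential
arithmetic height; (iii) a CLUSTER monster — super-polynomially many roots inside ONE octave [2^j, 2^{j+1}) (the
Chebyshev-in-format mechanism of the catalogued barrier `Literature.Barriers.ValiantsHypothesis.TauRealZeros`).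
VNP-hardness through this door needs to exclude (i) and (ii) ONLY: (iii) is invisible to `octaveCount`.
-/

set_option linter.dupNamespace false
set_option autoImplicit false

namespace Summit.ValiantsHypothesis.ValiantsHypothesis.Theorems.KPlusLogSqLaw.Octave

open Polynomial Finset
open scoped BigOperators
open Summit.ValiantsHypothesis.ValiantsHypothesis.Theorems.LacunarySymmetroidMatrixDescartes (RealRootLawAt KPlusLogSqLaw)
open Summit.ValiantsHypothesis.ValiantsHypothesis.Theses.LacunarySymmetroid (MatrixDescartes PencilTransfer ThetaWitness)
open Summit.ValiantsHypothesis.ValiantsHypothesis.Theses.KPlusLogSqLaw (TropicalB WeakLifting)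

/-! ## The statistic -/

/-- dyadic octave (scale) of a real number: `⌊log₂ |x|⌋` (junk `0`-ish values at `x = 0` are never used: we filter `x ≠ 0`). -/
noncomputable def octave (x : ℝ) : ℤ := Int.log 2 |x|

/-- number of dyadic octaves `[2^j, 2^{j+1})` containing `|x|` for some NONZERO real root `x` of `p`. -/
noncomputable def octaveCount (p : ℝ[X]) : ℕ :=
  ((p.roots.toFinset.filter (fun x => x ≠ 0)).image octave).card

/-- the octave count never exceeds the number of distinct real roots. [folklore] -/
theorem octaveCount_le_card (p : ℝ[X]) : octaveCount p ≤ p.roots.toFinset.card :=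
  card_image_le.trans (card_filter_le _ _)

/-- the lacunary symmetric pencil determinant of format `(m, K)` (same term as in `RealRootLawAt` / `MatrixDescartes`). -/
noncomputable def pencilDet {m K : ℕ} (d : Fin K → ℕ) (S : Fin K → Matrix (Fin m) (Fin m) ℝ) : ℝ[X] :=
  Matrix.det (∑ l, ((Polynomial.X : Polynomial ℝ) ^ d l) • (S l).map Polynomial.C)

/-! ## The octave rows and laws (all OPEN where their root-count twins are) -/

/-- census row, octave form: every real symmetric lacunary pencil of format `(m, K)` has roots in at most `B` octaves. -/
def OctaveRootLawAt (m K B : ℕ) : Prop :=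
  ∀ (d : Fin K → ℕ) (S : Fin K → Matrix (Fin m) (Fin m) ℝ), (∀ l, (S l).IsSymm) →
    octaveCount (Matrix.det (∑ l, ((Polynomial.X : Polynomial ℝ) ^ d l) • (S l).map Polynomial.C)) ≤ B

/-- **Ω-B**, the octave `K + log² m` law (candidate, NOT asserted; weaker than `KPlusLogSqLaw`). -/
def OctaveKLaw : Prop := ∃ C : ℕ, ∀ m K : ℕ, OctaveRootLawAt m K (2 ^ (C * (K + Nat.log 2 m ^ 2)))

/-- **Ω-MDR**, the octave form of crux `MatrixDescartes` (stmt-18050) (candidate, NOT asserted; weaker than it). -/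
def OctaveMatrixDescartes : Prop :=
  ∀ c q : ℕ, 0 < q → ∃ K₀ : ℕ, ∀ K m : ℕ, K₀ ≤ K → m ≤ 2 ^ ((Nat.log 2 K + c) ^ c) →
    ∀ (d : Fin K → ℕ) (S : Fin K → Matrix (Fin m) (Fin m) ℝ), (∀ l, (S l).IsSymm) →
      octaveCount (Matrix.det (∑ l, ((Polynomial.X : Polynomial ℝ) ^ d l) • (S l).map Polynomial.C)) ^ q
        ≤ 2 ^ (K * Nat.log 2 K)

/-- **Ω-W**, octave weak lifting (the line's CRUX; candidate, NOT asserted; weaker than `WeakLifting` stmt-19561):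
the tropical census row of format `(m, K)` (verbatim hypothesis of `WeakLifting`) bounds the number of root OCTAVES of
every real symmetric lacunary pencil of that format, with slack `2^{C (K + ⌊log₂ m⌋²)}`. -/
def OctaveWeakLifting : Prop :=
  ∃ C : ℕ, ∀ (m K n : ℕ), (∀ (d : Fin K → ℕ) (v ε : Fin m → Fin m → Fin K → ℤ) (n' : ℕ) (θ : Fin (n' + 1) → ℤ)
    (p : Fin (n' + 1) → Equiv.Perm (Fin m) × (Fin m → Fin K)), (∀ i j l, (ε i j l).natAbs ≤ 1) → StrictMono θ →
    (∀ k, Summit.ValiantsHypothesis.ValiantsHypothesis.Theorems.MatrixDescartes.Negative.IsDominant d v ε (θ k) (p k)) →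
    (∀ k : Fin n', Summit.ValiantsHypothesis.ValiantsHypothesis.Theorems.MatrixDescartes.Negative.termSign ε (p k.castSucc) *
      Summit.ValiantsHypothesis.ValiantsHypothesis.Theorems.MatrixDescartes.Negative.termSign ε (p k.succ) < 0) → n' ≤ n) →
    OctaveRootLawAt m K (2 ^ (C * (K + Nat.log 2 m ^ 2)) * (n + 1))

/-- **Ω-Θ**, the octave Theta witness (support; PROVED below by the tree's Tavenas family, `octaveThetaWitness_proof`): a real family with VNP complexification and exponents whose monomial restriction has nonzero real roots in at least
`2^{n⌊log₂ n⌋} - 1` distinct dyadic octaves, eventually in `n`. -/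
def OctaveThetaWitness : Prop :=
  ∃ (Θ : ∀ n : ℕ, MvPolynomial (Fin n) ℝ) (d : ∀ n : ℕ, Fin n → ℕ),
    Literature.Computability.AlgebraicComplexity.IsVNPFamily (fun n => MvPolynomial.map (algebraMap ℝ ℂ) (Θ n)) ∧
    ∃ n₀ : ℕ, ∀ n : ℕ, n₀ ≤ n →
      2 ^ (n * Nat.log 2 n) ≤ octaveCount (MvPolynomial.aeval (fun i => (Polynomial.X : Polynomial ℝ) ^ d n i) (Θ n)) + 1

/-! ## Every octave statement is weaker than its root-count twin (so no recorded refutation touches it that spares B) -/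

/-- An octave law is implied by the root-count law with the same bound (`octaveCount ≤ #roots`). [folklore] -/
theorem octaveRootLawAt_of_realRootLawAt {m K B : ℕ} (h : RealRootLawAt m K B) : OctaveRootLawAt m K B :=
  fun d S hS => (octaveCount_le_card _).trans (h d S hS)

/-- Monotonicity of the octave law in the bound. [folklore] -/
theorem octaveRootLawAt_mono {m K B B' : ℕ} (hBB' : B ≤ B') (h : OctaveRootLawAt m K B) : OctaveRootLawAt m K B' :=
  fun d S hS => (h d S hS).trans hBB'

/-- B ⇒ Ω-B. [folklore] -/
theorem octaveKLaw_of_kPlusLogSqLaw (h : KPlusLogSqLaw) : OctaveKLaw := by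
  obtain ⟨C, hC⟩ := h
  exact ⟨C, fun m K => octaveRootLawAt_of_realRootLawAt (hC m K)⟩

/-- MDR ⇒ Ω-MDR. [folklore] -/
theorem octaveMatrixDescartes_of_matrixDescartes (h : MatrixDescartes) : OctaveMatrixDescartes := by
  intro c q hq
  obtain ⟨K₀, hK⟩ := h c q hq
  refine ⟨K₀, fun K m hK0 hm d S hS => ?_⟩
  exact (Nat.pow_le_pow_left (octaveCount_le_card _) q).trans (hK K m hK0 hm d S hS)

/-- W ⇒ Ω-W. [folklore] -/
theorem octaveWeakLifting_of_weakLifting (h : WeakLifting) : OctaveWeakLifting := by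
  obtain ⟨C, hC⟩ := h
  exact ⟨C, fun m K n hT => octaveRootLawAt_of_realRootLawAt (hC m K n hT)⟩

/-- Θ-witness with ≥ N roots in distinct octaves is in particular a Θ-witness: Ω-Θ ⇒ ThetaWitness. [folklore] -/
theorem thetaWitness_of_octaveThetaWitness (h : OctaveThetaWitness) : ThetaWitness := by
  obtain ⟨Θ, d, hV, n₀, hn⟩ := h
  exact ⟨Θ, d, hV, n₀, fun n hn0 => (hn n hn0).trans (Nat.add_le_add_right (octaveCount_le_card _) 1)⟩

/-! ## The deciding chain on octaves (all glue PROVED; the open inputs are `TropicalB`, `OctaveWeakLifting`) -/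

/-- TB ∧ Ω-W ⇒ Ω-B (the three-line computation of p417903, octave form). [folklore] -/
theorem octaveKLaw_of_tropicalB_of_octaveWeakLifting (hT : TropicalB) (hW : OctaveWeakLifting) : OctaveKLaw := by
  obtain ⟨CT, hT⟩ := hT
  obtain ⟨CW, hW⟩ := hW
  refine ⟨CW + CT + 1, fun m K => ?_⟩
  have h1 := hW m K (2 ^ (CT * (K + Nat.log 2 m ^ 2))) (hT m K)
  rcases Nat.eq_zero_or_pos K with hK | hK
  · subst hK
    intro d S _
    have h0 : (∑ l : Fin 0, ((Polynomial.X : Polynomial ℝ) ^ d l) • (S l).map Polynomial.C) = 0 := by simp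
    rw [h0]
    rcases Nat.eq_zero_or_pos m with hm | hm
    · subst hm
      have : octaveCount (Matrix.det (0 : Matrix (Fin 0) (Fin 0) ℝ[X])) ≤ (Matrix.det (0 : Matrix (Fin 0) (Fin 0) ℝ[X])).roots.toFinset.card :=
        octaveCount_le_card _
      simp [Matrix.det_isEmpty] at this ⊢
      rw [this]; exact Nat.zero_le _
    · haveI : Nonempty (Fin m) := ⟨⟨0, hm⟩⟩
      have : octaveCount (Matrix.det (0 : Matrix (Fin m) (Fin m) ℝ[X])) ≤ (Matrix.det (0 : Matrix (Fin m) (Fin m) ℝ[X])).roots.toFinset.card :=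
        octaveCount_le_card _
      simp [Matrix.det_zero] at this ⊢
      rw [this]; exact Nat.zero_le _
  · refine octaveRootLawAt_mono ?_ h1
    have e1 : 2 ^ (CT * (K + Nat.log 2 m ^ 2)) + 1 ≤ 2 ^ (CT * (K + Nat.log 2 m ^ 2) + 1) :=
      Nat.pow_lt_pow_right (by norm_num) (Nat.lt_succ_self _)
    calc 2 ^ (CW * (K + Nat.log 2 m ^ 2)) * (2 ^ (CT * (K + Nat.log 2 m ^ 2)) + 1)
        ≤ 2 ^ (CW * (K + Nat.log 2 m ^ 2)) * 2 ^ (CT * (K + Nat.log 2 m ^ 2) + 1) := Nat.mul_le_mul_left _ e1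
      _ = 2 ^ (CW * (K + Nat.log 2 m ^ 2) + (CT * (K + Nat.log 2 m ^ 2) + 1)) := (pow_add _ _ _).symm
      _ ≤ 2 ^ ((CW + CT + 1) * (K + Nat.log 2 m ^ 2)) :=
        Nat.pow_le_pow_right (by norm_num) (by nlinarith [hK, Nat.zero_le (Nat.log 2 m ^ 2)])

/-- Ω-B ⇒ Ω-MDR (the arithmetic of `Census.matrixDescartes_of_kPlusLogSqLaw`, octave form). [folklore] -/
theorem octaveMatrixDescartes_of_octaveKLaw (h : OctaveKLaw) : OctaveMatrixDescartes := by
  obtain ⟨C, hC⟩ := h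
  intro c q _hq
  obtain ⟨K₁, hK₁⟩ := Summit.ValiantsHypothesis.ValiantsHypothesis.Theorems.LacunarySymmetroidMatrixDescartes.StubArith4.exp_le
    (2 * c) (2 * q * C)
  refine ⟨max K₁ (2 ^ (2 * q * C)), fun K m hK hm d S hS => ?_⟩
  have hK1 : K₁ ≤ K := le_of_max_le_left hK
  have hK2 : 2 ^ (2 * q * C) ≤ K := le_of_max_le_right hK
  have hL : 2 * q * C ≤ Nat.log 2 K := Nat.le_log_of_pow_le one_lt_two hK2
  have hlogm : Nat.log 2 m ≤ (Nat.log 2 K + c) ^ c :=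
    calc Nat.log 2 m ≤ Nat.log 2 (2 ^ ((Nat.log 2 K + c) ^ c)) := Nat.log_mono_right hm
      _ = (Nat.log 2 K + c) ^ c := Nat.log_pow one_lt_two _
  have hsq : Nat.log 2 m ^ 2 ≤ (Nat.log 2 K + 2 * c) ^ (2 * c) :=
    calc Nat.log 2 m ^ 2 ≤ ((Nat.log 2 K + c) ^ c) ^ 2 := Nat.pow_le_pow_left hlogm 2
      _ = (Nat.log 2 K + c) ^ (2 * c) := by rw [← pow_mul, mul_comm]
      _ ≤ (Nat.log 2 K + 2 * c) ^ (2 * c) := Nat.pow_le_pow_left (by omega) _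
  have hZ := hC m K d S hS
  have h1 : 2 * q * C * (Nat.log 2 K + 2 * c) ^ (2 * c) ≤ K * Nat.log 2 K := hK₁ K hK1
  have h2 : 2 * q * C * K ≤ K * Nat.log 2 K :=
    calc 2 * q * C * K = K * (2 * q * C) := by ring
      _ ≤ K * Nat.log 2 K := Nat.mul_le_mul_left K hL
  have hexp : q * (C * (K + Nat.log 2 m ^ 2)) ≤ K * Nat.log 2 K := by
    have h3 : q * C * Nat.log 2 m ^ 2 ≤ q * C * (Nat.log 2 K + 2 * c) ^ (2 * c) := Nat.mul_le_mul_left _ hsq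
    have e1 : q * (C * (K + Nat.log 2 m ^ 2)) = q * C * K + q * C * Nat.log 2 m ^ 2 := by ring
    have e2 : 2 * q * C * (Nat.log 2 K + 2 * c) ^ (2 * c) = 2 * (q * C * (Nat.log 2 K + 2 * c) ^ (2 * c)) := by ring
    have e3 : 2 * q * C * K = 2 * (q * C * K) := by ring
    rw [e2] at h1
    rw [e3] at h2
    omega
  calc octaveCount (Matrix.det (∑ l, ((Polynomial.X : Polynomial ℝ) ^ d l) • (S l).map Polynomial.C)) ^ q
      ≤ (2 ^ (C * (K + Nat.log 2 m ^ 2))) ^ q := Nat.pow_le_pow_left hZ q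
    _ = 2 ^ (q * (C * (K + Nat.log 2 m ^ 2))) := by rw [← pow_mul, mul_comm]
    _ ≤ 2 ^ (K * Nat.log 2 K) := Nat.pow_le_pow_right (by norm_num) hexp

/-- Ω-MDR ∧ Ω-Θ ⇒ VP_ℂ ≠ VNP_ℂ, with the CLOSED `pencilTransfer_proof` (stmt-18051) — it transfers root SETS, hence `octaveCount`.
(The arithmetic of route LacunarySymmetroid's `closes`, octave form.) [folklore] -/
theorem valiant_of_octaveMatrixDescartes (hMDR : OctaveMatrixDescartes) (hW : OctaveThetaWitness) :
    _root_.ValiantsHypothesis := by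
  have hT : PencilTransfer := Summit.ValiantsHypothesis.ValiantsHypothesis.Theorems.LacunarySymmetroid.pencilTransfer_proof
  show Literature.Computability.AlgebraicComplexity.VP ℂ ≠ Literature.Computability.AlgebraicComplexity.VNP ℂ
  intro hEq
  obtain ⟨Θ, d, hVNP, n₀, hroots⟩ := hW
  have hVP : Literature.Computability.AlgebraicComplexity.IsVPFamily
      (fun n => MvPolynomial.map (algebraMap ℝ ℂ) (Θ n)) := by
    have hmem := (Literature.Computability.AlgebraicComplexity.mem_VNP_ofFintype_iff_holds _).2 hVNP
    rw [← hEq] at hmem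
    exact (Literature.Computability.AlgebraicComplexity.mem_VP_ofFintype_iff_holds _).1 hmem
  obtain ⟨c, hc⟩ := hT (fun n => n) Θ hVP d
  obtain ⟨K₀, hK⟩ := hMDR c 4 (by norm_num)
  obtain ⟨n, hn₀, hnK, hn4⟩ : ∃ n, n₀ ≤ n ∧ K₀ ≤ n ∧ 4 ≤ n := ⟨n₀ + K₀ + 4, by omega, by omega, by omega⟩
  obtain ⟨m, hm, S, hS, hroot⟩ := hc n
  set Z := octaveCount (MvPolynomial.aeval (fun i => (Polynomial.X : Polynomial ℝ) ^ d n i) (Θ n)) with hZ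
  have hm' : m ≤ 2 ^ ((Nat.log 2 (n + 1) + c) ^ c) :=
    hm.trans (Nat.pow_le_pow_right (by norm_num)
      (Nat.pow_le_pow_left (Nat.add_le_add_right (Nat.log_mono_right (Nat.le_succ n)) c) c))
  have h1 := hK (n + 1) m (by omega) hm' (Fin.cons (α := fun _ => ℕ) (0 : ℕ) (d n)) S hS
  have hZeq : octaveCount (Matrix.det (∑ l, ((Polynomial.X : Polynomial ℝ) ^ (Fin.cons (α := fun _ => ℕ) (0 : ℕ) (d n) l)) •
      (S l).map Polynomial.C)) = Z := by
    rw [hZ, octaveCount, octaveCount, hroot]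
  rw [hZeq] at h1
  have h2 : 2 ^ (n * Nat.log 2 n) ≤ Z + 1 := hroots n hn₀
  set L := Nat.log 2 n with hL
  have hL2 : 2 ≤ L := by
    rw [hL]
    calc 2 = Nat.log 2 4 := by decide
      _ ≤ Nat.log 2 n := Nat.log_mono_right hn4
  have hLn : L ≤ n := by rw [hL]; exact Nat.log_le_self 2 n
  have hL' : Nat.log 2 (n + 1) ≤ L + 1 := by
    rw [hL]
    calc Nat.log 2 (n + 1) ≤ Nat.log 2 (n * 2) := Nat.log_mono_right (by omega)
      _ = Nat.log 2 n + 1 := Nat.log_mul_base (by norm_num) (by omega)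
  have h3 : Z ^ 4 ≤ 2 ^ ((n + 1) * (L + 1)) :=
    h1.trans (Nat.pow_le_pow_right (by norm_num) (Nat.mul_le_mul_left _ hL'))
  have hnL : 1 ≤ n * L := by nlinarith
  have h4 : 2 ^ (n * L - 1) ≤ Z := by
    have e : 2 ^ (n * L) = 2 * 2 ^ (n * L - 1) := by
      rw [← Nat.pow_succ']
      congr 1
      omega
    have h2' := h2
    rw [e] at h2'
    have : 1 ≤ 2 ^ (n * L - 1) := Nat.one_le_two_pow
    omega
  have h5 : 2 ^ (4 * (n * L - 1)) ≤ Z ^ 4 := by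
    rw [pow_mul']
    exact Nat.pow_le_pow_left h4 4
  have h6 : 4 * (n * L - 1) ≤ (n + 1) * (L + 1) :=
    (Nat.pow_le_pow_iff_right (by norm_num)).1 (h5.trans h3)
  have h7 : 6 * n ≤ 3 * (n * L) := by nlinarith
  have h6' : 4 * (n * L - 1) ≤ n * L + n + L + 1 := by
    have e : (n + 1) * (L + 1) = n * L + n + L + 1 := by ring
    rw [e] at h6
    exact h6
  generalize hP : n * L = P at h6' h7 hnL
  omega

/-- **The line's deciding composition** (kernel-checked; hypotheses = existing crux `TropicalB` (stmt-19771) + the two new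
items): `TropicalB → OctaveWeakLifting → OctaveThetaWitness → VP_ℂ ≠ VNP_ℂ`.  `WeakLifting` (stmt-19561) is NOT used. -/
theorem valiant_of_octave (hT : TropicalB) (hΩW : OctaveWeakLifting) (hΘ : OctaveThetaWitness) :
    _root_.ValiantsHypothesis :=
  valiant_of_octaveMatrixDescartes
    (octaveMatrixDescartes_of_octaveKLaw (octaveKLaw_of_tropicalB_of_octaveWeakLifting hT hΩW)) hΘ

end Summit.ValiantsHypothesis.ValiantsHypothesis.Theorems.KPlusLogSqLaw.Octave
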